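import Summits.MatrixMultiplication.MatrixMultiplication.Theorems.GradedDesignFamily.Negative.SubfieldCellTwentyfiveWallSharpData

/-!
# THE RELATION `Σ_ℓ d(g ℓ) = 0`, block `2` of `5`: invertible `g` over `𝔽₂₅` with `(g 0 0).im = 2`
# (EXACT wall of the `|K| = 25` subfield cell; crux `LevelGradedCohnUmans.GradedDesignFamily`, stmt-MatrixMultiplication-7610,
# negative side, stub S3 `stub_subfieldCell`, cell `q = 5`; gen 14, unit b2b-lgcu-subfield-g14)

HONEST FRAMING.  The stub `stub_subfieldCell` is ASYMPTOTIC; these files decide nothing about it or the summit.  They prove a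
THEOREM about ONE finite cell: in the standard model `k = 𝔽₅ = ZMod 5`, `K = 𝔽₂₅ = QuadraticAlgebra (ZMod 5) 2 0` (`i² = 2`),
`φ = Matrix.SpecialLinearGroup.mapGL K`, every separated design `(Y, Z)` of S3's clause has `|Y| + |Z| ≤ 104`
(`subfieldCell_twentyfive_wall_sharp`, file `SubfieldCellTwentyfiveWallSharp.lean`); with gen 14's row-one instance
`subfieldCell_twentyfive_witnessN` (`(|Y|, |Z|) = (1, 103)`) the maximum of `|Y| + |Z|` over the standard `q = 5` cell is EXACTLY `104`,
both sides theorems.  VALUE = THEOREM / CERTIFICATE, NOT summit progress.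

THIS FILE: one closed computation by `native_decide` (axiom `Lean.ofReduceBool`): for every `2 × 2` matrix `g` over
`𝔽₂₅ = QuadraticAlgebra (ZMod 5) 2 0` with `(g 0 0).im = 2` and non-zero determinant (`75000` matrices), the sum of
`d(g ℓ)` (`d = 30 κ` of `SubfieldCellTwentyfiveWallSharpData`) over the `26` line representatives `ℓ ∈ {(0,1)} ∪ {(1,x)}` vanishes.
(`κ` is constant on lines and `Σ_{L ∈ P¹(K)} κ(L) = 0`, so the relation is "g permutes the lines"; it is verified here by
exhaustion, which keeps the certificate elementary.)  The five blocks are dispatched in `SubfieldCellTwentyfiveWallSharp.lean`.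
-/

set_option linter.dupNamespace false
set_option linter.style.longLine false
set_option linter.style.setOption false

open scoped BigOperators
open Matrix Module

namespace Summit.MatrixMultiplication.MatrixMultiplication.Theorems.GradedDesignFamily.Negative

set_option maxHeartbeats 20000000 in
set_option maxRecDepth 4000 in
set_option synthInstance.maxHeartbeats 2000000 in
set_option synthInstance.maxSize 1000000 in
/-- THE RELATION on block `2`: `(g 0 0).im = 2`. -/
theorem subfieldCell_twentyfive_sharp_rel2 :
    letI : Fintype (QuadraticAlgebra (ZMod 5) 2 0) := (Fintype.ofEquiv _ (QuadraticAlgebra.equivProd (2 : ZMod 5) 0).symm : Fintype (QuadraticAlgebra (ZMod 5) 2 0))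
    ∀ g ∈ (Finset.univ : Finset (Matrix (Fin 2) (Fin 2) (QuadraticAlgebra (ZMod 5) 2 0))), (g 0 0).im = 2 →
      g 0 0 * g 1 1 - g 0 1 * g 1 0 ≠ 0 →
        ∑ ℓ ∈ insert ![⟨0, 0⟩, ⟨1, 0⟩] (Finset.univ.image fun x : QuadraticAlgebra (ZMod 5) 2 0 => ![⟨1, 0⟩, x]),
          subfieldCell_twentyfive_sharp_d (Matrix.mulVec (g : Matrix (Fin 2) (Fin 2) (QuadraticAlgebra (ZMod 5) 2 0)) ℓ) = 0 := by
  native_decide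

end Summit.MatrixMultiplication.MatrixMultiplication.Theorems.GradedDesignFamily.Negative
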